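import Summits.CriticalPhenomena.PercolationContinuityZ3.Theorems.Transplant.SkelPhiSeedSlabAvoid
import Summits.CriticalPhenomena.PercolationContinuityZ3.Theorems.Transplant.SkelPhiSlabRect
import Summits.CriticalPhenomena.PercolationContinuityZ3.Theorems.Transplant.SkelStepIVInputs
import Summits.CriticalPhenomena.PercolationContinuityZ3.Theorems.Transplant.KNLevelsStepIVOut
import Summits.CriticalPhenomena.PercolationContinuityZ3.Theorems.Transplant.BoxProdZ2KitStepIV
import HarnessLib

/-!
# D″ node, φ-level generic layer ((B″), V98 p1 column 'SkelNKits'): the PINNING SET and the KIT CLAUSE of a window level for a bare planar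
# map — φ-level re-cut of `SkelKits` (p237686) with the Step-IV estimate of a near contact taken as a PER-CONTACT HYPOTHESIS (`hcon`, right
# branch), so that the clause is independent of the kit SHAPE: the two-scale rectangle kit of D″ (p3-g7's `SkelPhiRectAt` + Step-IV kit, rooms
# from `SkelPhiSlabRect`) discharges that hypothesis, exactly as `Skel.kit_hIV_of_le/_of_route` did for the Lemma-9 cube of the node of record

builds on p205010 (kernel theorem, internal audit signed; external expert review pending) — nothing in this file uses p205010.
Lane `prim-bschramm`, seat `prim-bschramm-p1` (gen 9); helper file (`--supports stmt-CriticalPhenomena-4575 --as helper`).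
* §1 **`pinSet`** `= Win (Icc (Lo + 2ℓs + 2) (Hi − 2ℓs − 2)) R ∪ Yfar` (shell window ∪ inner neighbours of the far contacts): `shellWin_subset_pinSet`,
  `pinSet_subset_winLevel`, `pinSet_spec` (the `hT` shape of `Skelφ.slabSeedDeep_notMem_wireSet`, from `Lip`);
* §2 **`kitClause`** — the per-level clause `hkits` of `KNLevels.TStep.KitsAt` / `Skel.WinStepData.kitsAt_tstep`: `∃ σ S, SHyp L j σ ∧ σ.N ≤ N ∧
  (1 − q^{sB})^k ≤ δ ∧ S ⊆ B⟨j⟩ ∧ S ⊆ D ∧ seeds off wireSet S ∧ faces ⊆ S ∧ hIV`, with `σ := kitSData G φ hΔ … (slabGeomDeep … Unear)`,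
  `S := pinSet …`, from the slab constants (`kitOK_slabDeep`), the near-face conditions `NearFaceOKDeep` + faces in the shell box (`hUsh`),
  and the per-contact dichotomy `hcon`: a face vertex in `T` (edge-contact remedy, `hIV_of_mem_face`), or — near contact — the Step-IV
  estimate for the face `Unear x` with pinning set `pinSet …` (the output of the kit's Step IV);
* §3 **`kitClause'`** — the same clause with the TWO-SCALE RECTANGLE KIT of D″ (DPRIME-SCOPE p3 addendum L.3): faces `rectU` (near sides of
  the band rectangles behind the deep slab, `SkelPhiSlabRect`), kit region `Qk := rectPrismFin c (A i) (Rk i) ∪ Λc c n` pinned in the shell window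
  (`rectPrism_subset_shellWin`, `zoneBox_subset_shellWin`), relay face disjoint from the zone box (`disjoint_rectU_zoneBox`: exit offset
  `A i i ≥ n + 1`), and Step IV by p3-g7's engine `KNLevels.stepIV_out` from the `G`-level inputs AT THE KIT CENTRE (zone of the family `Λc c`
  between `kz` and `n`; link seed → near side inside the fat rectangle) transferred to the window graph's subbox weighting
  (`Skel.real_eq_of_isSubbox_of_le`, `zone_anti_graph`) and the route datum — the per-contact hypothesis `hcon'`.  The zone family
  `Λc : V → ℕ → Finset V` is a datum (Step I′'s `D.Λ`, `SkelPhiInputs`) with the two ROOM properties `Λc c n ⊆ B_G(c, ρ) ∩ cyl c n` used here.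
[cite: KozmaNitzan2024, §4 Lemma 10, Steps III–V (pp. 19–22): "Q ⊆ S"] [cite: GrimmettPercolation1999, §7.2]
-/

noncomputable section

open scoped Classical

namespace Summit.CriticalPhenomena.PercolationContinuityZ3.Theorems.Transplant

namespace Skelφ

open MeasureTheory
open Literature.Probability.Percolation Literature.Probability.LatticeModels SimpleGraph KNLevels
open Literature.Barriers.CriticalPhenomena (graphBall graphBall_finite mem_graphBall_self graphBall_mono)
open Skel (winGraph winGraph_adj winGraph_le KitGeom)
open SkelI (tanOff tanTgt tanTgt_mem)
open Literature.Probability.Percolation.KozmaNitzan.Cells (oth oth_ne eq_oth_of_ne oth_oth)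

variable {V : Type} [DecidableEq V] (G : SimpleGraph V) [G.LocallyFinite] (φ : V → Site 2)

/-! ## §1 The pinning set: shell window ∪ far inner neighbours -/

/-- **The pinning set of the window level `j`**: the shell window `Win (Icc (Lo + 2ℓs + 2) (Hi − 2ℓs − 2)) R` together with the inner
neighbours of the FAR candidate contacts (`y ∉ B_G(w₀, R − r₀)`). [cite: KozmaNitzan2024, §4 p. 21 ("Q ⊆ S")] -/
def pinSet (w₀ : V) (R : ℕ) (lo hi : Site 2) (j ℓs r₀ : ℕ) : Finset V :=
  Win G φ w₀ (Finset.Icc ((lo - (j : Site 2)) + ((2 * ℓs + 2 : ℕ) : Site 2)) ((hi + (j : Site 2)) - ((2 * ℓs + 2 : ℕ) : Site 2))) R ∪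
    ((outerBoundary (winGraph G w₀ R) (winLevel G φ w₀ R lo hi j)).filter fun x =>
        inNbr G φ w₀ R (Finset.Icc (lo - (j : Site 2)) (hi + (j : Site 2))) x ∉ graphBall G w₀ (R - r₀)).image
      fun x => inNbr G φ w₀ R (Finset.Icc (lo - (j : Site 2)) (hi + (j : Site 2))) x

/-- The shell window lies in the pinning set. [folklore] -/
theorem shellWin_subset_pinSet (w₀ : V) (R : ℕ) (lo hi : Site 2) (j ℓs r₀ : ℕ) :
    Win G φ w₀ (Finset.Icc ((lo - (j : Site 2)) + ((2 * ℓs + 2 : ℕ) : Site 2)) ((hi + (j : Site 2)) - ((2 * ℓs + 2 : ℕ) : Site 2))) R ⊆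
      pinSet G φ w₀ R lo hi j ℓs r₀ :=
  Finset.subset_union_left

/-- The inner neighbour of a FAR candidate contact lies in the pinning set. [folklore] -/
theorem inNbr_mem_pinSet {w₀ : V} {R : ℕ} {lo hi : Site 2} {j : ℕ} (ℓs : ℕ) {r₀ : ℕ} {x : V}
    (hx : x ∈ outerBoundary (winGraph G w₀ R) (winLevel G φ w₀ R lo hi j))
    (hfar : inNbr G φ w₀ R (Finset.Icc (lo - (j : Site 2)) (hi + (j : Site 2))) x ∉ graphBall G w₀ (R - r₀)) :
    inNbr G φ w₀ R (Finset.Icc (lo - (j : Site 2)) (hi + (j : Site 2))) x ∈ pinSet G φ w₀ R lo hi j ℓs r₀ := by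
  rw [pinSet, Finset.mem_union, Finset.mem_image]
  exact Or.inr ⟨x, Finset.mem_filter.2 ⟨hx, hfar⟩, rfl⟩

/-- The pinning set lies in the level `B⟨j⟩`. [folklore] -/
theorem pinSet_subset_winLevel (w₀ : V) (R : ℕ) (lo hi : Site 2) (j ℓs r₀ : ℕ) :
    pinSet G φ w₀ R lo hi j ℓs r₀ ⊆ winLevel G φ w₀ R lo hi j := by
  intro v hv
  rw [pinSet, Finset.mem_union] at hv
  rw [mem_winLevel_iff]
  rcases hv with hv | hv
  · rw [mem_Win] at hv
    refine ⟨hv.1, ?_⟩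
    have h := hv.2
    rw [Finset.mem_Icc, Pi.le_def, Pi.le_def] at h ⊢
    refine ⟨fun i => ?_, fun i => ?_⟩
    · have h1 := h.1 i; simp only [Pi.add_apply, Pi.natCast_apply] at h1; push_cast at h1; linarith
    · have h2 := h.2 i; simp only [Pi.sub_apply, Pi.natCast_apply] at h2; push_cast at h2; linarith
  · rw [Finset.mem_image] at hv
    obtain ⟨x, hx, rfl⟩ := hv
    rw [Finset.mem_filter] at hx
    have h := inNbr_spec (P := Finset.Icc (lo - (j : Site 2)) (hi + (j : Site 2))) hx.1
    exact ⟨h.2.1, h.2.2⟩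

variable {G φ} in
/-- Members of the pinning set are shell vertices or far boundary-layer vertices (the `hT` shape of `slabSeedDeep_notMem_wireSet`; `Lip`
puts the far inner neighbours on the boundary layer). [folklore] -/
theorem pinSet_spec (hlip : Lip G φ) (w₀ : V) (R : ℕ) (lo hi : Site 2) (j ℓs r₀ : ℕ) :
    ∀ v ∈ (↑(pinSet G φ w₀ R lo hi j ℓs r₀) : Set V), φ v ∈ Finset.Icc (lo - (j : Site 2)) (hi + (j : Site 2)) ∧
      (φ v ∈ Finset.Icc ((lo - (j : Site 2)) + ((2 * ℓs + 2 : ℕ) : Site 2)) ((hi + (j : Site 2)) - ((2 * ℓs + 2 : ℕ) : Site 2)) ∨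
        (φ v ∉ Finset.Icc ((lo - (j : Site 2)) + 1) ((hi + (j : Site 2)) - 1) ∧ v ∉ graphBall G w₀ (R - r₀))) := by
  intro v hv
  rw [Finset.mem_coe] at hv
  refine ⟨((mem_winLevel_iff G φ).1 (pinSet_subset_winLevel G φ w₀ R lo hi j ℓs r₀ hv)).2, ?_⟩
  rw [pinSet, Finset.mem_union] at hv
  rcases hv with hv | hv
  · exact Or.inl ((mem_Win G φ).1 hv).2
  · right
    rw [Finset.mem_image] at hv
    obtain ⟨x, hx, rfl⟩ := hv
    rw [Finset.mem_filter] at hx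
    refine ⟨fun hin => ?_, hx.2⟩
    obtain ⟨i, hface⟩ := exists_coord_eq_of_contact hlip (Lo := (lo - (j : Site 2))) (Hi := (hi + (j : Site 2))) hx.1
    rw [Finset.mem_Icc, Pi.le_def, Pi.le_def] at hin
    have h1 := hin.1 i; have h2 := hin.2 i
    rcases hface with hf | hf <;> rw [hf] at h1 h2 <;>
      simp only [Pi.add_apply, Pi.sub_apply, Pi.natCast_apply, Pi.one_apply] at h1 h2 <;> omega

/-! ## §2 The kit clause -/

variable {G φ}

/-- **The kit clause of `KitsAt` / `TargetProperty` for a window level of a bare planar map** (exploration graph `winGraph G w₀ R`), for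
ANY near-face map `Unear` meeting `NearFaceOKDeep` with faces in the shell box, given per contact either a face vertex in the target or the
Step-IV estimate of the near face with pinning set `pinSet …` (the kit's output). [cite: KozmaNitzan2024, §4 Lemma 10, Steps III–IV (pp. 19–21)] -/
theorem kitClause [Countable V] (hlip : Lip G φ) (hstep : Steps G φ) {Δ : ℕ} (hΔ : ∀ v, G.degree v ≤ Δ) {q : unitInterval} {δ : ℝ}
    (hδ : 0 < δ)
    -- the window level and the slab constants
    {w₀ : V} {R : ℕ} {lo hi : Site 2} {j ℓs M R' r₀ rs : ℕ} (hℓs : 1 ≤ ℓs)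
    (hwide : ∀ i, (lo - (j : Site 2)) i + 2 * tanOff ℓs M ≤ (hi + (j : Site 2)) i)
    (hR' : ∀ c : V, graphBall G c (ℓs + 2 + 2 * tanOff ℓs M) ∩ cyl φ c ℓs ⊆ cylBall G φ c ℓs R')
    (hr₀ : ℓs + 1 + tanOff ℓs M + R' ≤ r₀) (hR : r₀ ≤ R) (hrs : ℓs + 2 + tanOff ℓs M + R' ≤ rs)
    -- the near faces: kit conditions and ROOM (faces in the shell box)
    {Unear : V → Finset V} {cU : ℕ} (hU : NearFaceOKDeep G φ w₀ R lo hi j ℓs M R' r₀ rs cU Unear)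
    (hUsh : ∀ x ∈ outerBoundary (winGraph G w₀ R) (winLevel G φ w₀ R lo hi j), ∀ u ∈ Unear x,
      φ u ∈ Finset.Icc ((lo - (j : Site 2)) + ((2 * ℓs + 2 : ℕ) : Site 2)) ((hi + (j : Site 2)) - ((2 * ℓs + 2 : ℕ) : Site 2)))
    -- the level's source/support, the weighting, the region (a subbox containing the level) and the target
    (k : ℕ) (o : V) (Sfin : Finset V) {Wt : Sym2 V → unitInterval} {D T : Finset V}
    (hXD : winLevel G φ w₀ R lo hi j ⊆ D) {N : ℕ} (hN : k * (Δ + 1) ^ (2 * rs) ≤ N)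
    (hk : (1 - (q : ℝ) ^ (1 + Δ * ((Δ + 1) ^ R' + (tanOff ℓs M + 2)) + ((Δ + 1) ^ R' + (tanOff ℓs M + 2)) * cU)) ^ k ≤ δ)
    -- per contact: a face vertex in the target, or (near contact) the Step-IV estimate of the near face
    (hcon : ∀ x ∈ outerBoundary (winGraph G w₀ R) (winLevel G φ w₀ R lo hi j),
      (∃ u ∈ (slabGeomDeep G φ w₀ R lo hi j ℓs M R' r₀ Unear).U x, u ∈ T) ∨
      (inNbr G φ w₀ R (Finset.Icc (lo - (j : Site 2)) (hi + (j : Site 2))) x ∈ graphBall G w₀ (R - r₀) ∧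
        1 - 3 * δ ≤ (prodBernoulli Wt).real {ω | ∃ u ∈ Unear x,
          1 - δ < (prodBernoulli (pinW Wt (wireSet (↑(pinSet G φ w₀ R lo hi j ℓs r₀) : Set V)) ω)).real
            (⋃ t ∈ T, openConnIn (↑D : Set V) u t)})) :
    ∃ (σ : SData V) (S : Finset V), SHyp (winLData G φ w₀ R lo hi o Sfin) j σ ∧ σ.N ≤ N ∧
      (1 - (q : ℝ) ^ σ.sB) ^ σ.k ≤ δ ∧ S ⊆ (winLData G φ w₀ R lo hi o Sfin).X j ∧ S ⊆ D ∧
      (∀ x ∈ σ.K, ∀ e ∈ σ.seed x, e ∉ wireSet (↑S : Set V)) ∧ (∀ x ∈ σ.K, σ.face x ⊆ S) ∧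
      (∀ x ∈ σ.K, 1 - 3 * δ ≤ (prodBernoulli Wt).real {ω | ∃ u ∈ σ.face x,
        1 - δ < (prodBernoulli (pinW Wt (wireSet (↑S : Set V)) ω)).real (⋃ t ∈ T, openConnIn (↑D : Set V) u t)}) := by
  set κ := slabGeomDeep G φ w₀ R lo hi j ℓs M R' r₀ Unear with hκ
  set Spin := pinSet G φ w₀ R lo hi j ℓs r₀ with hSpin
  have hOK := kitOK_slabDeep hlip hstep hΔ hwide hR' hr₀ hR hrs hU
  have hSX : Spin ⊆ winLevel G φ w₀ R lo hi j := pinSet_subset_winLevel G φ w₀ R lo hi j ℓs r₀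
  have hSD : Spin ⊆ D := hSX.trans hXD
  -- faces lie in the pinning set
  have hface : ∀ x ∈ outerBoundary (winGraph G w₀ R) (winLevel G φ w₀ R lo hi j), κ.U x ⊆ Spin := by
    intro x hx u hu
    simp only [hκ, slabGeomDeep] at hu
    split_ifs at hu with hnear
    · exact shellWin_subset_pinSet G φ w₀ R lo hi j ℓs r₀
        ((mem_Win G φ).2 ⟨((mem_winLevel_iff G φ).1 (hU.sub x hx hnear hu)).1, hUsh x hx u hu⟩)
    · rw [Finset.mem_singleton] at hu
      rw [hu]
      exact inNbr_mem_pinSet G φ ℓs hx hnear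
  refine ⟨kitSData G φ hΔ w₀ R lo hi j κ rs ((Δ + 1) ^ R' + (tanOff ℓs M + 2)) cU k, Spin,
    shyp_kit hOK hlip o Sfin k, hN, hk, by rw [winLData_X]; exact hSX, hSD, fun x hx e he => ?_, fun x hx => ?_, fun x hx => ?_⟩
  · rw [kitSData_K] at hx; rw [kitSData_seed] at he
    exact slabSeedDeep_notMem_wireSet hlip hstep hℓs hwide hUsh hx (pinSet_spec hlip w₀ R lo hi j ℓs r₀) he
  · rw [kitSData_K] at hx; rw [kitSData_face]; exact hface x hx
  · rw [kitSData_K] at hx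
    rw [kitSData_face]
    rcases hcon x hx with ⟨u, hu, huT⟩ | ⟨hnear, hIV⟩
    · exact hIV_of_mem_face hδ hu huT (hSD (hface x hx hu))
    · have hUx : κ.U x = Unear x := by simp only [hκ, slabGeomDeep, if_pos hnear]
      rw [hUx]; exact hIV

/-! ## §3 The kit clause with the two-scale rectangle kit (Step IV via `KNLevels.stepIV_out`) -/

section TwoScale

variable {types : Finset V} {w₀ : V} {R : ℕ} {lo hi : Site 2} {j ℓs M : ℕ} {A : Fin 2 → Fin 2 → ℕ} {Rk : Fin 2 → ℕ} {K : ℕ}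

/-- **A zone box about the kit centre of a NEAR contact lies in the shell window**: any set `Z ⊆ B_G(c, ρ)` with planar footprint in
`φ c + Λ_n` (`c = rectCtr …` behind the deep slab, `n ≤ A i i`, `n ≤ M`, reach `ℓs + 1 + A i i + ρ ≤ K`, `r₀ ≥ ℓs + 2 + T₀ + K`) lies in
`Win w₀ (Icc (Lo + (2ℓs+2)) (Hi − (2ℓs+2))) R`. [cite: KozmaNitzan2024, §4 p. 21 ("Q ⊆ S")] -/
theorem zoneBox_subset_shellWin (hlip : Lip G φ) (hstep : Steps G φ) {n ρ r₀ : ℕ}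
    (hwide : ∀ i, (lo - (j : Site 2)) i + 2 * tanOff ℓs M ≤ (hi + (j : Site 2)) i) (hA : ∀ i k, A i k ≤ M) (hnA : ∀ i, n ≤ A i i)
    (hnM : n ≤ M) (hρK : ∀ i, ℓs + 1 + A i i + ρ ≤ K) (hr₀ : ℓs + 2 + tanOff ℓs M + K ≤ r₀) (hR : r₀ ≤ R) {x : V}
    (hx : x ∈ outerBoundary (winGraph G w₀ R) (winLevel G φ w₀ R lo hi j))
    (hnear : inNbr G φ w₀ R (Finset.Icc (lo - (j : Site 2)) (hi + (j : Site 2))) x ∈ graphBall G w₀ (R - r₀)) {Z : Finset V}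
    (hZ : ∀ z ∈ Z, z ∈ graphBall G (rectCtr hstep (deepCtr G φ w₀ R (lo - (j : Site 2)) (hi + (j : Site 2)) ℓs M x)
        (exitDir G φ w₀ R (lo - (j : Site 2)) (hi + (j : Site 2)) x).1 (exitDir G φ w₀ R (lo - (j : Site 2)) (hi + (j : Site 2)) x).2 ℓs
        (A (exitDir G φ w₀ R (lo - (j : Site 2)) (hi + (j : Site 2)) x).1)) ρ ∧
      z ∈ cyl φ (rectCtr hstep (deepCtr G φ w₀ R (lo - (j : Site 2)) (hi + (j : Site 2)) ℓs M x)
        (exitDir G φ w₀ R (lo - (j : Site 2)) (hi + (j : Site 2)) x).1 (exitDir G φ w₀ R (lo - (j : Site 2)) (hi + (j : Site 2)) x).2 ℓs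
        (A (exitDir G φ w₀ R (lo - (j : Site 2)) (hi + (j : Site 2)) x).1)) n) :
    Z ⊆ Win G φ w₀ (Finset.Icc (lo - (j : Site 2) + ((2 * ℓs + 2 : ℕ) : Site 2)) (hi + (j : Site 2) - ((2 * ℓs + 2 : ℕ) : Site 2))) R := by
  have hx' : x ∈ outerBoundary (winGraph G w₀ R) (Win G φ w₀ (Finset.Icc (lo - (j : Site 2)) (hi + (j : Site 2))) R) := hx
  obtain ⟨-, -, hyP⟩ := inNbr_spec hx'
  have hty := (deepCtr_spec hstep (ℓs := ℓs) (M := M) hwide hyP).1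
  have hexit := φ_deepCtr_exit hstep (ℓs := ℓs) (M := M) hwide hyP
  have htan := φ_deepCtr_tan hstep (ℓs := ℓs) (M := M) hwide hyP
  have htgt := tanTgt_mem (Lo := lo - (j : Site 2)) (Hi := hi + (j : Site 2)) (ℓs := ℓs) (M := M)
    (oth (exitDir G φ w₀ R (lo - (j : Site 2)) (hi + (j : Site 2)) x).1) (hwide _)
    (φ (inNbr G φ w₀ R (Finset.Icc (lo - (j : Site 2)) (hi + (j : Site 2))) x))
  have hspec := exitDir_spec hlip hx'
  have hAi := hA (exitDir G φ w₀ R (lo - (j : Site 2)) (hi + (j : Site 2)) x).1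
  have hnAi := hnA (exitDir G φ w₀ R (lo - (j : Site 2)) (hi + (j : Site 2)) x).1
  have hρKi := hρK (exitDir G φ w₀ R (lo - (j : Site 2)) (hi + (j : Site 2)) x).1
  have hc := rectCtr_spec hstep (deepCtr G φ w₀ R (lo - (j : Site 2)) (hi + (j : Site 2)) ℓs M x)
    (exitDir G φ w₀ R (lo - (j : Site 2)) (hi + (j : Site 2)) x).1 (exitDir G φ w₀ R (lo - (j : Site 2)) (hi + (j : Site 2)) x).2 ℓs
    (A (exitDir G φ w₀ R (lo - (j : Site 2)) (hi + (j : Site 2)) x).1)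
  have hφc := φ_rectCtr hstep (deepCtr G φ w₀ R (lo - (j : Site 2)) (hi + (j : Site 2)) ℓs M x)
    (exitDir G φ w₀ R (lo - (j : Site 2)) (hi + (j : Site 2)) x).1 (exitDir G φ w₀ R (lo - (j : Site 2)) (hi + (j : Site 2)) x).2 ℓs
    (A (exitDir G φ w₀ R (lo - (j : Site 2)) (hi + (j : Site 2)) x).1)
  intro z hz
  obtain ⟨hzc, hzcyl⟩ := hZ z hz
  rw [mem_Win]
  refine ⟨?_, ?_⟩
  · have hcy := BoxProdZ2.mem_graphBall_add G hty hc.1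
    have hcw := BoxProdZ2.mem_graphBall_add G hnear hcy
    exact graphBall_mono G w₀ (by omega) (BoxProdZ2.mem_graphBall_add G hcw hzc)
  · have hb := (mem_cyl φ _ n z).1 hzcyl
    rw [mem_box] at hb
    generalize hI : (exitDir G φ w₀ R (lo - (j : Site 2)) (hi + (j : Site 2)) x).1 = I at hexit htan htgt hspec hφc hb hAi hnAi
    generalize hS : (exitDir G φ w₀ R (lo - (j : Site 2)) (hi + (j : Site 2)) x).2 = sg at hexit hspec hφc hb
    generalize hB : A I = a at hφc hb hAi hnAi
    generalize hC' : rectCtr hstep (deepCtr G φ w₀ R (lo - (j : Site 2)) (hi + (j : Site 2)) ℓs M x) I sg ℓs a = c at hφc hb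
    generalize hT : deepCtr G φ w₀ R (lo - (j : Site 2)) (hi + (j : Site 2)) ℓs M x = t at hexit htan hφc
    generalize hY : inNbr G φ w₀ R (Finset.Icc (lo - (j : Site 2)) (hi + (j : Site 2))) x = y at hyP hexit htan htgt hspec
    generalize hτ : tanTgt (lo - (j : Site 2)) (hi + (j : Site 2)) ℓs M (oth I) (φ y) = τ at htan htgt
    rw [Finset.mem_Icc] at hyP
    obtain ⟨hyl, hyh⟩ := hyP
    obtain ⟨hcI, hcO⟩ := hφc
    have hT₀ : (tanOff ℓs M : ℤ) = 2 * ℓs + 2 + M := by simp [tanOff]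
    have hwI := hwide I
    have hbI := hb I
    have hbO := hb (oth I)
    simp only [Pi.sub_apply] at hbI hbO
    have haI : ((a I : ℕ) : ℤ) ≤ M := by exact_mod_cast hAi I
    have hnaI : (n : ℤ) ≤ a I := by exact_mod_cast hnAi
    have hnM' : (n : ℤ) ≤ M := by exact_mod_cast hnM
    have hI' : (lo - (j : Site 2)) I + (2 * ℓs + 2 : ℕ) ≤ φ z I ∧ φ z I ≤ (hi + (j : Site 2)) I - (2 * ℓs + 2 : ℕ) := by
      rcases hspec with ⟨rfl, hf⟩ | ⟨rfl, hf⟩ <;> push_cast at hcI hexit ⊢ <;> constructor <;> linarith [hbI.1, hbI.2]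
    have hO' : (lo - (j : Site 2)) (oth I) + (2 * ℓs + 2 : ℕ) ≤ φ z (oth I) ∧
        φ z (oth I) ≤ (hi + (j : Site 2)) (oth I) - (2 * ℓs + 2 : ℕ) := by
      push_cast at htgt ⊢
      rw [htan] at hcO
      constructor <;> linarith [htgt.1, htgt.2, hbO.1, hbO.2]
    rw [Finset.mem_Icc]
    constructor <;> intro k
    · have goal : (lo - (j : Site 2) + ((2 * ℓs + 2 : ℕ) : Site 2)) k ≤ φ z k := by
        rw [Pi.add_apply, Pi.natCast_apply]
        by_cases hk : k = I
        · rw [hk]; exact hI'.1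
        · rw [eq_oth_of_ne hk]; exact hO'.1
      exact goal
    · have goal : φ z k ≤ (hi + (j : Site 2) - ((2 * ℓs + 2 : ℕ) : Site 2)) k := by
        rw [Pi.sub_apply, Pi.natCast_apply]
        by_cases hk : k = I
        · rw [hk]; exact hI'.2
        · rw [eq_oth_of_ne hk]; exact hO'.2
      exact goal

omit [DecidableEq V] in
/-- **The near side is disjoint from the zone box**: a near-side vertex has exit offset exactly `σ (A i i)` from the kit centre, a zone-box
vertex at most `n < A i i`. [cite: KozmaNitzan2024, §4 p. 21 (U1′: the near side at skeleton distance M_u + 1)] -/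
theorem disjoint_nearSide_of_subset_cyl [DecidableEq V] (hstep : Steps G φ) {t : V} {i : Fin 2} {σ : ℤˣ} {ℓs : ℕ} {a : Fin 2 → ℕ}
    {Rr n : ℕ} (hna : n + 1 ≤ a i) {Z : Finset V} (hZ : ∀ z ∈ Z, z ∈ cyl φ (rectCtr hstep t i σ ℓs a) n) :
    Disjoint (nearSide G hstep t i σ ℓs a Rr) Z := by
  rw [Finset.disjoint_left]
  intro u hu huZ
  rw [nearSide] at hu
  have hside := ((mem_rside G φ).1 hu).2
  have hb := (mem_box.1 ((mem_cyl φ _ n u).1 (hZ u huZ))) i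
  simp only [Pi.sub_apply] at hb
  have hna' : (n : ℤ) + 1 ≤ a i := by exact_mod_cast hna
  rcases Int.units_eq_one_or σ with rfl | rfl <;> push_cast at hside <;> omega

/-- **The kit clause with the two-scale rectangle kit** (D″, `KNLevels.stepIV_out`): as `kitClause` with faces `rectU` (near sides of the band
rectangles behind the deep slab, half-widths `A i`, radii `Rk i` per exit axis), the zone family `Λc c` (Step I′'s `D.Λ`) between the seed
level `kz` and the zone scale `n` with the room properties `Λc c n ⊆ B_G(c, ρ) ∩ cyl c n`, `n + 1 ≤ A i i`, and, per near contact, the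
`G`-level inputs AT THE KIT CENTRE `c = rectCtr …` (uniqueness zone; link seed → near side inside the fat rectangle, both `> 1 − δ²` at the
running density `q`) together with the route datum (`Ft ⊆ T`, `Qt ⊆ D`, `Ft` off the zone box, link seed → `Ft` inside `Qt` under the subbox
weighting). [cite: KozmaNitzan2024, §4 Lemma 10, Steps III–IV (pp. 19–21)] -/
theorem kitClause' [Countable V] (hlip : Lip G φ) (hstep : Steps G φ) (hfr : Frames G φ types) (hκ : CylConn G φ types) {Δ : ℕ}
    (hΔ : ∀ v, G.degree v ≤ Δ) {q : unitInterval} {δ : ℝ} (hδ : 0 < δ)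
    -- the window level, the slab constants, the kit rectangles and the zone boxes
    {R' r₀ rs : ℕ} (hℓs : 1 ≤ ℓs) (hwide : ∀ i, (lo - (j : Site 2)) i + 2 * tanOff ℓs M ≤ (hi + (j : Site 2)) i)
    (hA : ∀ i k, A i k ≤ M) (hAℓ : ∀ i, A i (oth i) ≤ ℓs) (hK : ∀ i, ℓs + 1 + A i i + Rk i ≤ K)
    (Λc : V → ℕ → Finset V) {kz n ρ : ℕ} (hkn : ∀ c, Λc c kz ⊆ Λc c n)
    (hΛρ : ∀ c, ∀ z ∈ Λc c n, z ∈ graphBall G c ρ ∧ z ∈ cyl φ c n) (hnA : ∀ i, n + 1 ≤ A i i) (hnM : n ≤ M)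
    (hρK : ∀ i, ℓs + 1 + A i i + ρ ≤ K)
    (hR'₁ : cylRadMax G φ types ℓs (ℓs + 2 + 2 * tanOff ℓs M) ≤ R') (hR'₂ : ∀ i, cylRadMax G φ types ℓs (ℓs + 2 + A i i + Rk i) ≤ R')
    (hr₀₁ : ℓs + 1 + tanOff ℓs M + R' ≤ r₀) (hr₀₂ : ℓs + 2 + tanOff ℓs M + K ≤ r₀) (hR : r₀ ≤ R)
    (hrs₁ : ℓs + 2 + tanOff ℓs M + R' ≤ rs) (hrs₂ : ℓs + 2 + tanOff ℓs M + K ≤ rs) {cU : ℕ} (hcU : ∀ i, (Δ + 1) ^ Rk i ≤ cU)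
    -- the level's source/support, the weighting, the region and the target
    (k : ℕ) (o : V) (Sfin : Finset V) {Wt : Sym2 V → unitInterval} {D T : Finset V}
    (hWD : IsSubbox (winGraph G w₀ R) Wt q D) (hXD : winLevel G φ w₀ R lo hi j ⊆ D) {N : ℕ} (hN : k * (Δ + 1) ^ (2 * rs) ≤ N)
    (hk : (1 - (q : ℝ) ^ (1 + Δ * ((Δ + 1) ^ R' + (tanOff ℓs M + 2)) + ((Δ + 1) ^ R' + (tanOff ℓs M + 2)) * cU)) ^ k ≤ δ)
    -- the per-contact dichotomy
    (hcon' : ∀ x ∈ outerBoundary (winGraph G w₀ R) (winLevel G φ w₀ R lo hi j),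
      (∃ u ∈ (slabGeomDeep G φ w₀ R lo hi j ℓs M R' r₀ (rectU hstep w₀ R lo hi j ℓs M A Rk)).U x, u ∈ T) ∨
      (inNbr G φ w₀ R (Finset.Icc (lo - (j : Site 2)) (hi + (j : Site 2))) x ∈ graphBall G w₀ (R - r₀) ∧
        1 - δ ^ 2 < (bondPercolation G q).real (UniqZone.zone G
          (Λc (rectCtr hstep (deepCtr G φ w₀ R (lo - (j : Site 2)) (hi + (j : Site 2)) ℓs M x)
            (exitDir G φ w₀ R (lo - (j : Site 2)) (hi + (j : Site 2)) x).1 (exitDir G φ w₀ R (lo - (j : Site 2)) (hi + (j : Site 2)) x).2 ℓs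
            (A (exitDir G φ w₀ R (lo - (j : Site 2)) (hi + (j : Site 2)) x).1))) kz n) ∧
        1 - δ ^ 2 < (bondPercolation G q).real (linkIn
          (rectPrism G φ (rectCtr hstep (deepCtr G φ w₀ R (lo - (j : Site 2)) (hi + (j : Site 2)) ℓs M x)
            (exitDir G φ w₀ R (lo - (j : Site 2)) (hi + (j : Site 2)) x).1 (exitDir G φ w₀ R (lo - (j : Site 2)) (hi + (j : Site 2)) x).2 ℓs
            (A (exitDir G φ w₀ R (lo - (j : Site 2)) (hi + (j : Site 2)) x).1))
            (A (exitDir G φ w₀ R (lo - (j : Site 2)) (hi + (j : Site 2)) x).1) (Rk (exitDir G φ w₀ R (lo - (j : Site 2)) (hi + (j : Site 2)) x).1))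
          (Λc (rectCtr hstep (deepCtr G φ w₀ R (lo - (j : Site 2)) (hi + (j : Site 2)) ℓs M x)
            (exitDir G φ w₀ R (lo - (j : Site 2)) (hi + (j : Site 2)) x).1 (exitDir G φ w₀ R (lo - (j : Site 2)) (hi + (j : Site 2)) x).2 ℓs
            (A (exitDir G φ w₀ R (lo - (j : Site 2)) (hi + (j : Site 2)) x).1)) kz)
          (rectU hstep w₀ R lo hi j ℓs M A Rk x)) ∧
        ∃ Qt Ft : Finset V, Ft ⊆ T ∧ Qt ⊆ D ∧
          Disjoint Ft (Λc (rectCtr hstep (deepCtr G φ w₀ R (lo - (j : Site 2)) (hi + (j : Site 2)) ℓs M x)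
            (exitDir G φ w₀ R (lo - (j : Site 2)) (hi + (j : Site 2)) x).1 (exitDir G φ w₀ R (lo - (j : Site 2)) (hi + (j : Site 2)) x).2 ℓs
            (A (exitDir G φ w₀ R (lo - (j : Site 2)) (hi + (j : Site 2)) x).1)) n) ∧
          1 - δ ^ 2 < (prodBernoulli Wt).real (linkIn (↑Qt)
            (Λc (rectCtr hstep (deepCtr G φ w₀ R (lo - (j : Site 2)) (hi + (j : Site 2)) ℓs M x)
              (exitDir G φ w₀ R (lo - (j : Site 2)) (hi + (j : Site 2)) x).1 (exitDir G φ w₀ R (lo - (j : Site 2)) (hi + (j : Site 2)) x).2 ℓs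
              (A (exitDir G φ w₀ R (lo - (j : Site 2)) (hi + (j : Site 2)) x).1)) kz) Ft))) :
    ∃ (σ : SData V) (S : Finset V), SHyp (winLData G φ w₀ R lo hi o Sfin) j σ ∧ σ.N ≤ N ∧
      (1 - (q : ℝ) ^ σ.sB) ^ σ.k ≤ δ ∧ S ⊆ (winLData G φ w₀ R lo hi o Sfin).X j ∧ S ⊆ D ∧
      (∀ x ∈ σ.K, ∀ e ∈ σ.seed x, e ∉ wireSet (↑S : Set V)) ∧ (∀ x ∈ σ.K, σ.face x ⊆ S) ∧
      (∀ x ∈ σ.K, 1 - 3 * δ ≤ (prodBernoulli Wt).real {ω | ∃ u ∈ σ.face x,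
        1 - δ < (prodBernoulli (pinW Wt (wireSet (↑S : Set V)) ω)).real (⋃ t ∈ T, openConnIn (↑D : Set V) u t)}) := by
  -- the slab region's cylinder-ball radius from frames + (κ)
  have hR'slab : ∀ c : V, graphBall G c (ℓs + 2 + 2 * tanOff ℓs M) ∩ cyl φ c ℓs ⊆ cylBall G φ c ℓs R' := fun c v hv =>
    cylBall_mono G φ c le_rfl hR'₁ (graphBall_inter_cyl_subset_cylBall' hfr hκ c hℓs (ℓs + 2 + 2 * tanOff ℓs M) hv)
  have hU := nearFaceOK_rect (w₀ := w₀) hlip hstep hfr hκ hΔ hℓs hwide hA hAℓ hK hR'₂ hr₀₂ hR hrs₂ hcU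
  have hUsh := rectU_mem_shellBox hlip hstep hwide hA hK (w₀ := w₀) (R := R) (lo := lo) (hi := hi) (j := j) (Rk := Rk)
  -- the shell window is pinned and lies in the region
  have hshellD : Win G φ w₀ (Finset.Icc (lo - (j : Site 2) + ((2 * ℓs + 2 : ℕ) : Site 2)) (hi + (j : Site 2) - ((2 * ℓs + 2 : ℕ) : Site 2))) R ⊆ D :=
    ((shellWin_subset_pinSet G φ w₀ R lo hi j ℓs r₀).trans (pinSet_subset_winLevel G φ w₀ R lo hi j ℓs r₀)).trans hXD
  have hshellB : ∀ v ∈ Win G φ w₀ (Finset.Icc (lo - (j : Site 2) + ((2 * ℓs + 2 : ℕ) : Site 2))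
      (hi + (j : Site 2) - ((2 * ℓs + 2 : ℕ) : Site 2))) R, v ∈ graphBall G w₀ R := fun v hv => ((mem_Win G φ).1 hv).1
  refine kitClause hlip hstep hΔ hδ hℓs hwide hR'slab hr₀₁ hR hrs₁ hU hUsh k o Sfin hXD hN hk fun x hx => ?_
  rcases hcon' x hx with h | ⟨hnear, hz, hl, Qt, Ft, hFT, hQD, hdisj, h3⟩
  · exact Or.inl h
  · refine Or.inr ⟨hnear, ?_⟩
    generalize hI : (exitDir G φ w₀ R (lo - (j : Site 2)) (hi + (j : Site 2)) x).1 = I at hz hl hdisj h3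
    generalize hS : (exitDir G φ w₀ R (lo - (j : Site 2)) (hi + (j : Site 2)) x).2 = sg at hz hl hdisj h3
    have hrectU : rectU hstep w₀ R lo hi j ℓs M A Rk x =
        nearSide G hstep (deepCtr G φ w₀ R (lo - (j : Site 2)) (hi + (j : Site 2)) ℓs M x) I sg ℓs (A I) (Rk I) := by
      rw [rectU, hI, hS]
    -- ROOM: the rectangle and the zone box lie in the shell window
    have hrectS := rectPrism_subset_shellWin hlip hstep hwide hA hK (le_trans (by omega) hr₀₂) hR hx hnear
    have hzoneS := zoneBox_subset_shellWin hlip hstep hwide hA (fun i => (Nat.le_succ n).trans (hnA i)) hnM hρK hr₀₂ hR hx hnear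
      (hΛρ _)
    rw [hI, hS] at hrectS hzoneS
    set t := deepCtr G φ w₀ R (lo - (j : Site 2)) (hi + (j : Site 2)) ℓs M x with ht
    set c := rectCtr hstep t I sg ℓs (A I) with hc
    set Qk : Finset V := rectPrismFin G φ c (A I) (Rk I) ∪ Λc c n with hQk
    have hQkS' : Qk ⊆ Win G φ w₀ (Finset.Icc (lo - (j : Site 2) + ((2 * ℓs + 2 : ℕ) : Site 2))
        (hi + (j : Site 2) - ((2 * ℓs + 2 : ℕ) : Site 2))) R := Finset.union_subset hrectS hzoneS
    have hQkS : Qk ⊆ pinSet G φ w₀ R lo hi j ℓs r₀ := hQkS'.trans (shellWin_subset_pinSet G φ w₀ R lo hi j ℓs r₀)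
    have hQkD : Qk ⊆ D := hQkS'.trans hshellD
    have hQkB : ∀ v ∈ Qk, v ∈ graphBall G w₀ R := fun v hv => hshellB v (hQkS' hv)
    have hΛQk : Λc c n ⊆ Qk := Finset.subset_union_right
    have hrectQk : rectPrismFin G φ c (A I) (Rk I) ⊆ Qk := Finset.subset_union_left
    have hUfar : Disjoint (nearSide G hstep t I sg ℓs (A I) (Rk I)) (Λc c n) :=
      disjoint_nearSide_of_subset_cyl hstep (hnA I) fun z hz' => (hΛρ c z hz').2
    -- the inputs, transferred to the subbox weighting of the window graph
    have h1 : 1 - δ ^ 2 < (prodBernoulli Wt).real (UniqZone.zone (winGraph G w₀ R) (Λc c) kz n) := by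
      have heq := Skel.real_eq_of_isSubbox_of_le (winGraph_le G w₀ R) hWD (hΛQk.trans hQkD)
        (Skel.adj_winGraph_of_subset_graphBall fun v hv => hQkB v (hΛQk hv))
        (determinedBy_zone (G := G) (Λc c) kz n le_rfl) (measurableSet_zone (G := G) (Λc c) kz n)
      refine hz.trans_le ?_
      rw [← heq]
      exact measureReal_mono (zone_anti_graph (winGraph_le G w₀ R) (Λc c) kz n) (measure_ne_top _ _)
    have h2 : 1 - δ ^ 2 < (prodBernoulli Wt).real (linkIn (↑Qk) (Λc c kz) (nearSide G hstep t I sg ℓs (A I) (Rk I))) := by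
      have heq := Skel.real_eq_of_isSubbox_of_le (winGraph_le G w₀ R) hWD (hrectQk.trans hQkD)
        (Skel.adj_winGraph_of_subset_graphBall fun v hv => hQkB v (hrectQk hv))
        (determinedBy_linkIn (rectPrism G φ c (A I) (Rk I)) (Λc c kz) (nearSide G hstep t I sg ℓs (A I) (Rk I))
          (by rw [coe_rectPrismFin]))
        (by rw [← coe_rectPrismFin]; exact measurableSet_linkIn _ _ _)
      rw [hrectU] at hl
      rw [← heq] at hl
      refine hl.trans_le (measureReal_mono (linkIn_mono ?_ subset_rfl subset_rfl) (measure_ne_top _ _))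
      rw [← coe_rectPrismFin]
      exact Finset.coe_subset.2 hrectQk
    rw [hrectU]
    exact KNLevels.stepIV_out (G := winGraph G w₀ R) hWD hFT hQD (Λc c) (hkn c) hQkD hQkS hΛQk hUfar hdisj hδ (Rg := (↑D : Set V))
      (Finset.coe_subset.2 hQkD) (Finset.coe_subset.2 hQD) h1 h2 h3

end TwoScale

end Skelφ

end Summit.CriticalPhenomena.PercolationContinuityZ3.Theorems.Transplant

end
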